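import Summits.BirchSwinnertonDyer.BirchSwinnertonDyer.Theorems.ResidualThetaTransportAtTwoThetaLayerLambdaCongruenceAtTwoCuspSpanRowConjugation
import Mathlib.Data.Nat.ChineseRemainder
import HarnessLib

/-!
# Route `ResidualThetaTransportAtTwo`, cruxes Kan⁺ (stmt-BirchSwinnertonDyer-20688) / node 27436 / 21437: RELATIONS on the rows
# `B_m = {b = −m}` — products `P β₃` with `P` killed and `β₃ ∈ B₁`, and a CRT supply of auxiliary integers

Cell `bsd-wall`, width seat `bsd-wall-rtt-p3-w4` g2 (2026-08-28), memo `Cruxes/ThetaLayerLambdaCongruenceAtTwo/Lines/birth-rows-allodd.md`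
§3 (Claim B). THEOREMS ONLY; `--supports stmt-BirchSwinnertonDyer-20688`; BSD is not proved by this.

* §1 `exists_int_avoiding` — CRT: an integer `D` with `α D + β ≢ 0 (mod ℓ)` for every prime `ℓ ∣ N` and every constraint
  `(α, β)` of a finite list attached to `ℓ`, provided fewer than `ℓ` residues are excluded at each `ℓ`.
* §2 `exists_row_of_killed` — for `P = (A, −S; Nc, D) ∈ Γ₀(N)` with `χ P = 0`, and `δ₃` prime to `N` with `A + S δ₃ = m`:
  the product `P β₃` (`β₃ = (∗, −1; ∗, δ₃)`) lies on the row `b = −m`, has `χ = χ(β₃)` … `= 0` when `χ` kills `B₁`, and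
  `S · d(Pβ₃) = D m − 1` (exactly).
* §3 the two free families: `exists_row_d_eq_two` (`P = T^{−(m−1)/2}`: an element of `B_m` with `d = 2`, killed) and
  `exists_row_d_eq_mul_sub_one` (`P = β_D`: an element of `B_m` with `d = Dm − 1`, killed, for every `D` with
  `D ≢ 0, m⁻¹` modulo the primes of `N`).

References: [Rademacher1929] §1; [IrelandRosen1990] Ch. 3 (CRT); [Pollack2003] Conj. 6.3.
-/

set_option autoImplicit false
set_option linter.dupNamespace false

noncomputable section

open scoped MatrixGroups Function

open CongruenceSubgroup

namespace Summit.BirchSwinnertonDyer.BirchSwinnertonDyer.Theorems.SignedMuAtTwo.Rows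

variable {N : ℕ} {χ : Gamma0 N → ZMod 2}

/-! ## §1. CRT: an integer avoiding prescribed roots of linear congruences at every prime of `N` -/

omit χ in
/-- **CRT avoidance.** Given, for each prime `ℓ ∣ N`, a finite set `C ℓ` of linear constraints `(α, β)`, such that the excluded
residues `{−β/α}` number fewer than `ℓ`: an integer `D` with `ℓ ∤ α D + β` for all of them. [cite: IrelandRosen1990, Ch. 3] -/
theorem exists_int_avoiding (C : ℕ → Finset (ℤ × ℤ))
    (hC : ∀ ℓ ∈ N.primeFactors,
      ((C ℓ).image (fun c : ℤ × ℤ ↦ -((c.2 : ℤ) : ZMod ℓ) * ((c.1 : ℤ) : ZMod ℓ)⁻¹)).card < ℓ) :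
    ∃ D : ℤ, ∀ ℓ ∈ N.primeFactors, ∀ c ∈ C ℓ, ¬ ((ℓ : ℤ) ∣ c.1) → ¬ ((ℓ : ℤ) ∣ c.1 * D + c.2) := by
  classical
  -- at each prime pick a residue outside the excluded set
  have hpick : ∀ ℓ ∈ N.primeFactors, ∃ r : ℕ, ∀ c ∈ C ℓ, ¬ ((ℓ : ℤ) ∣ c.1) → ¬ ((ℓ : ℤ) ∣ c.1 * r + c.2) := by
    intro ℓ hℓ
    have hℓp := Nat.prime_of_mem_primeFactors hℓ
    haveI := Fact.mk hℓp
    set B := (C ℓ).image (fun c : ℤ × ℤ ↦ -((c.2 : ℤ) : ZMod ℓ) * ((c.1 : ℤ) : ZMod ℓ)⁻¹)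
    obtain ⟨x, -, hx⟩ := Finset.exists_mem_notMem_of_card_lt_card
      (by rw [Finset.card_univ, ZMod.card]; exact hC ℓ hℓ : B.card < (Finset.univ : Finset (ZMod ℓ)).card)
    refine ⟨x.val, fun c hc hα hdvd ↦ hx ?_⟩
    rw [Finset.mem_image]
    refine ⟨c, hc, ?_⟩
    have hα' : ((c.1 : ℤ) : ZMod ℓ) ≠ 0 := by
      rwa [Ne, ZMod.intCast_zmod_eq_zero_iff_dvd]
    have e : ((c.1 : ℤ) : ZMod ℓ) * (x.val : ZMod ℓ) + ((c.2 : ℤ) : ZMod ℓ) = 0 := by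
      have := (ZMod.intCast_zmod_eq_zero_iff_dvd _ ℓ).mpr hdvd
      push_cast at this
      exact this
    rw [ZMod.natCast_zmod_val] at e
    field_simp
    linear_combination -e
  choose! a ha using hpick
  have hs : ∀ ℓ ∈ N.primeFactors, (id ℓ : ℕ) ≠ 0 := fun ℓ hℓ ↦ (Nat.prime_of_mem_primeFactors hℓ).ne_zero
  have pp : Set.Pairwise (N.primeFactors : Set ℕ) (Nat.Coprime on id) := by
    intro ℓ hℓ ℓ' hℓ' hne
    exact (Nat.coprime_primes (Nat.prime_of_mem_primeFactors hℓ) (Nat.prime_of_mem_primeFactors hℓ')).mpr hne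
  obtain ⟨k, hk⟩ := Nat.chineseRemainderOfFinset a id N.primeFactors hs pp
  refine ⟨k, fun ℓ hℓ c hc hα hdvd ↦ ha ℓ hℓ c hc hα ?_⟩
  -- `k ≡ a ℓ (mod ℓ)` transports the divisibility
  have hmod : (ℓ : ℤ) ∣ (a ℓ : ℤ) - k := by simpa using (hk ℓ hℓ).dvd
  have := dvd_add hdvd (hmod.mul_left c.1)
  have e : c.1 * (k : ℤ) + c.2 + c.1 * ((a ℓ : ℤ) - k) = c.1 * (a ℓ : ℤ) + c.2 := by ring
  rwa [e] at this

/-! ## §2. The product `P β₃` -/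

/-- **Row relation.** `χ` additive killing `B₁`; `P ∈ Γ₀(N)` with `b(P) = −S` and `χ P = 0`; `δ₃` prime to `N` with
`a(P) + S δ₃ = m`. Then there is an element of `Γ₀(N)` with `b = −m`, `χ = 0` and lower-right entry `d` satisfying
`S d = d(P) m − 1`. [cite: Rademacher1929, §1] -/
theorem exists_row_of_killed [NeZero N]
    (hadd : ∀ γ δ : Gamma0 N, χ (γ * δ) = χ γ + χ δ)
    (hB1 : ∀ β : Gamma0 N, (β : SL(2, ℤ)) 0 1 = -1 → χ β = 0)
    {P : Gamma0 N} (hP : χ P = 0) (S : ℤ) (hbP : (P : SL(2, ℤ)) 0 1 = -S) (m : ℤ)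
    (δ₃ : ℤ) (hδ₃ : (P : SL(2, ℤ)) 0 0 + S * δ₃ = m) (hcop : IsCoprime δ₃ (N : ℤ)) :
    ∃ γ : Gamma0 N, (γ : SL(2, ℤ)) 0 1 = -m ∧ χ γ = 0 ∧ S * (γ : SL(2, ℤ)) 1 1 = (P : SL(2, ℤ)) 1 1 * m - 1 := by
  obtain ⟨α₃, t, h3⟩ := hcop
  obtain ⟨β₃, -, b01, b10, b11⟩ := ThetaLayerLambdaCongruenceAtTwo.exists_gamma0_entries (N := N)
    α₃ (-1) ((N : ℤ) * t) δ₃ (by linear_combination h3) (dvd_mul_right _ _)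
  have hdet := Matrix.SpecialLinearGroup.det_coe (P : SL(2, ℤ))
  rw [Matrix.det_fin_two, hbP] at hdet
  refine ⟨P * β₃, ?_, ?_, ?_⟩
  · rw [gamma0_mul_apply_zero_one, hbP, b01, b11]; linear_combination -hδ₃
  · rw [hadd, hP, hB1 β₃ b01, add_zero]
  · rw [gamma0_mul_apply_one_one', b01, b11]
    linear_combination (P : SL(2, ℤ)) 1 1 * hδ₃ - hdet

/-! ## §3. The two free families -/

/-- **An element of the row `b = −m` with `d = 2`, killed** (`m ≥ 3` odd, `N` odd): `P = T^{−(m−1)/2}`, `δ₃ = 2`.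
[cite: Pollack2003, Conj. 6.3] -/
theorem exists_row_d_eq_two [NeZero N] (hN : Odd N)
    (hadd : ∀ γ δ : Gamma0 N, χ (γ * δ) = χ γ + χ δ)
    (hsmall : ∀ γ : Gamma0 N, ((γ : SL(2, ℤ)) 0 0 + (γ : SL(2, ℤ)) 1 1).natAbs ≤ 2 → χ γ = 0)
    (hB1 : ∀ β : Gamma0 N, (β : SL(2, ℤ)) 0 1 = -1 → χ β = 0)
    (m : ℕ) (hm : Odd m) (hm3 : 3 ≤ m) :
    ∃ γ : Gamma0 N, (γ : SL(2, ℤ)) 0 1 = -(m : ℤ) ∧ χ γ = 0 ∧ (γ : SL(2, ℤ)) 1 1 = 2 := by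
  obtain ⟨h, hh⟩ : ∃ h : ℕ, m = 2 * h + 1 := hm
  obtain ⟨P, p00, p01, -, p11⟩ :=
    ThetaLayerLambdaCongruenceAtTwo.exists_gamma0_entries (N := N) 1 (-(h : ℤ)) 0 1 (by ring) (dvd_zero _)
  have hP : χ P = 0 := hsmall P (by rw [p00, p11]; decide)
  have hcop : IsCoprime (2 : ℤ) (N : ℤ) := by
    obtain ⟨w, hw⟩ : Odd (N : ℤ) := by exact_mod_cast hN
    exact ⟨-w, 1, by rw [hw]; ring⟩
  obtain ⟨γ, hb, hχ, hd⟩ := exists_row_of_killed hadd hB1 hP h (by rw [p01]) m 2 (by rw [p00, hh]; push_cast; ring) hcop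
  refine ⟨γ, hb, hχ, ?_⟩
  rw [p11, one_mul, hh] at hd
  push_cast at hd
  have h0 : (h : ℤ) ≠ 0 := by
    have : h ≠ 0 := by omega
    exact_mod_cast this
  exact mul_left_cancel₀ h0 (by linear_combination hd)

/-- **An element of the row `b = −m` with `d = Dm − 1`, killed**, for every `D` prime to `N` with `m − D⁻¹` prime to `N`
(stated as: some integer `A` with `N ∣ 1 − A D` and `m − A` prime to `N`): `P = β_D = (A, −1; ∗, D)`, `δ₃ = m − A`.
[cite: Pollack2003, Conj. 6.3] -/
theorem exists_row_d_eq_mul_sub_one [NeZero N]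
    (hadd : ∀ γ δ : Gamma0 N, χ (γ * δ) = χ γ + χ δ)
    (hB1 : ∀ β : Gamma0 N, (β : SL(2, ℤ)) 0 1 = -1 → χ β = 0)
    (m : ℤ) (D A : ℤ) (hAD : (N : ℤ) ∣ 1 - A * D) (hcop : IsCoprime (m - A) (N : ℤ)) :
    ∃ γ : Gamma0 N, (γ : SL(2, ℤ)) 0 1 = -m ∧ χ γ = 0 ∧ (γ : SL(2, ℤ)) 1 1 = D * m - 1 := by
  obtain ⟨P, p00, p01, p11⟩ := TriangleN.exists_b_neg_one_entries (N := N) A D hAD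
  obtain ⟨γ, hb, hχ, hd⟩ := exists_row_of_killed hadd hB1 (hB1 P p01) 1 (by rw [p01]) m (m - A)
    (by rw [p00]; ring) hcop
  exact ⟨γ, hb, hχ, by rw [one_mul, p11] at hd; exact hd⟩

end Summit.BirchSwinnertonDyer.BirchSwinnertonDyer.Theorems.SignedMuAtTwo.Rows

end
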